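import Literature.AlgebraicGeometry.HodgeTheory.BettiHypersurfaceMiddleBettiNumberClosedFormSurfaceDiamond
import Literature.AlgebraicGeometry.HodgeTheory.MaxRationalSubHodgeStructureKunnethSymmetric
import HarnessLib

/-!
# Odd-dimensional smooth hypersurfaces `X ⊂ ℙ^{2r+2}_ℂ` times `Z`, NUMERICALLY: `HC(X × Z)` ⟸ `HC(Z)` and `h^{r+1+k, r−k}(X) · h^{t+1+k, t−k}(Z) = 0` (`0 ≤ k ≤ min(r,t)`, `2t+1` the top odd
# degree of `Z`); every (regular) surface × every odd-dimensional hypersurface; hypersurface threefolds × `Z` (Voisin I §11.3.3 Lemma 11.41; Voisin II Cor. 1.24–1.25, Prop. 9.20; Deligne 2000 §1)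

Family `hodge`, lane `lit-hodgefound` (Track 2 foundations library; Layers A1/A4), layer `Literature/AlgebraicGeometry/HodgeTheory`.  THEOREMS ONLY (no definition, no named fact, no instance,
no notation; D-0026 net debt `0`).  Prover seat `lit-hodgefound-p21` (generation 41, row g41-#3), sequel of g40-#7 (`BettiHodgeConjectureProductsNumericalLevelCriterion`: `HC(Y × Z)` ⟸ `HC(Y)`,
`HC(Z)`, the half-level products of the top ODD degrees and the level products of the top EVEN degrees) and of g41-#1∕#2 (`h^{m,0}` of a hypersurface, the off-middle Hodge numbers).

THE MATHEMATICS.  Let `X ⊂ ℙ^{2r+2}_ℂ` be a smooth hypersurface of ODD dimension `m = 2r + 1`.  By the Lefschetz hyperplane theorem (Voisin II Cor. 1.24–1.25) `b_k(X) = 0` for odd `k ≠ m` and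
`H^{2p}(X;ℚ) = ℚ · h^p` for `2p ≠ m`, so `HC(X)` holds (the tree's `IsSmoothHypersurface.hodgeConjectureFor_of_odd`) and the top even degree `2r` of `X` carries a Hodge structure PURE of type
`(r,r)`: `h^{r+k, r−k}(X) = 0` for `k ≥ 1` (§1).  Hence in the seat's numerical level criterion for `X × Z` the even-degree products `h^{r+k,r−k}(X) · h^{ν+k,ν−k}(Z)` vanish identically, and
**`HC(X × Z)` ⟸ `HC(Z)` and `h^{r+1+k, r−k}(X) · h^{t+1+k, t−k}(Z) = 0` for `0 ≤ k ≤ min(r, t)`** (`2t+1` the top odd degree of `Z`; §2) — ONE family of products, read off `Hᵐ(X)` and the top odd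
cohomology of `Z`.  In the FANO range `deg X ≤ 2r + 2` the top level `k = r` drops (`h^{2r+1,0}(X) = 0`, g41-#1).  Against a SURFACE (`t = 0`) the single product is `q(S) · h^{r+1,r}(X)`, and the
seat's surface criterion (g40-#7 §3: `q(S) · h^{t+1,t}(Z) = 0`, `p_g(S) · h^{ν+1,ν−1}(Z) = 0`) loses its `p_g`-clause: **`HC(S × X)` ⟸ `q(S) · h^{r+1,r}(X) = 0` for every smooth projective surface `S`
and every odd-dimensional smooth hypersurface `X`** — in particular **every REGULAR surface (`q = 0`: surfaces in `ℙ³`, Enriques surfaces, …) times every odd-dimensional hypersurface satisfies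
the Hodge conjecture** (§3).  For hypersurface THREEFOLDS `T ⊂ ℙ⁴` (`r = 1`): `HC(T × Z)` ⟸ `HC(Z)`, `h^{2,1}(T) · h^{t+1,t}(Z) = 0`, [`t ≥ 1`:] `h^{3,0}(T) · h^{t+2,t−1}(Z) = 0`; in degree `≤ 4` (quadric,
cubic, quartic threefolds) only the first product remains — e.g. **a cubic threefold times any threefold `T′` with `h^{2,1}(T′) = 0`**, **a quadric threefold times anything with `HC`** — and for
the quintic threefold (`h^{3,0} = 1`) the second reads `h^{t+2,t−1}(Z) = 0` (§4).

THE PRINTS.  C. Voisin (2002) [VoisinHodgeI2002] §7.1.1 (Hodge decomposition and symmetry), §11.1.2 Prop. 11.20, §11.3.1 Thm. 11.30 (Lefschetz `(1,1)`), §11.3.3 Thm. 11.38–11.40, Lemma 11.41,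
pp. 285–287 (Hodge classes on products).  C. Voisin (2003) [VoisinHodgeII2003] §1.2.3 Cor. 1.24 («`Hᵏ(X, ℤ) ≅ Hᵏ(ℙⁿ⁺¹, ℤ)` for `k < n`»), Cor. 1.25, §9.2.4 Prop. 9.20.  D. Huybrechts (2016)
[Huybrechts2016K3] Ch. 3 Def. 2.5, Lemma 3.1.  P. Deligne (1971) [DeligneHodgeII1971] 1.2.5, 2.1.13; (2000) [Deligne2000] §1.  R. Hartshorne (1977) [Hartshorne1977] II Example 8.20.3 (`ω_Y ≅ 𝒪_Y(d−n−1)`,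
`p_g = 0` for `d ≤ n`).  D. Eisenbud, J. Harris (2016) [EisenbudHarris2016] Example 5.24, Table 5.1 (`b₃(quadric threefold) = 0`).  D. Arapura (2012) [Arapura2012] §17.3 (17.3.1).

THE OBJECTS (all the tree's).  `IsSmoothHypersurface`, `IsSmoothProjective.tensor_holds`, `HodgeConjectureFor`, `BettiUniverse.hodge hHD hX k` with `hodgeNumber`, `hodgeClasses`;
`IsSmoothHypersurface.hodgeConjectureFor_of_odd`, `…hodgeClasses_hodge_eq_top_of_two_mul_ne` (p29), `HodgeStructure.hodgeNumber_eq_zero_of_hodgeClasses_eq_top`, the seat's g40-#7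
`BettiUniverse.hodgeConjectureFor_tensor_of_forall_hodgeNumber_mul_eq_zero`, `…hodgeConjectureFor_surface_tensor_of_hodgeNumber_mul_eq_zero`, g41-#1 `hodgeNumber_hodge_top_zero_eq_zero_of_le`,
`hodgeNumber_three_zero_eq_zero_of_le_four`, g41-#2 `hodgeNumber_hodge_eq_zero_of_odd`, `finrank_bettiCohomology_middle_odd_le_div`, `hodgeConjectureFor_tensor_comm`, `hodgeConjectureFor_of_dim_le_three_holds`.

WHAT IS PROVED.
* §1 `IsSmoothHypersurface.hodgeNumber_hodge_eq_zero_of_two_mul_ne` (`h^{p′,q′}(H^{2p}X) = 0`, `p′ ≠ p`, `2p ≠ m`).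
* §2 **`IsSmoothHypersurface.hodgeConjectureFor_tensor_of_odd_of_forall_hodgeNumber_mul_eq_zero`** (`X × Z`), `…tensor_right_of_odd_…` (`Z × X`), **`…tensor_of_odd_of_le_of_forall_hodgeNumber_mul_eq_zero`** (Fano range, `k < r`).
* §3 **`IsSmoothHypersurface.hodgeConjectureFor_surface_tensor_of_odd_of_hodgeNumber_mul_eq_zero`** (`HC(S × X)` ⟸ `q(S)·h^{r+1,r}(X) = 0`), **`…surface_tensor_of_odd_of_q_zero`**, `…tensor_surface_of_odd_of_q_zero`,
  `…surface_tensor_of_odd_of_isSmoothHypersurface_two` (`S ⊂ ℙ³`).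
* §4 **`IsSmoothHypersurface.hodgeConjectureFor_threefold_tensor_of_hodgeNumber_mul_eq_zero`**, **`…threefold_of_le_four_tensor_of_hodgeNumber_mul_eq_zero`**, `…_of_hodgeNumber_eq_zero`,
  **`…threefold_of_le_four_tensor_threefold_of_h21_eq_zero`**, `…tensor_threefolds_of_le_four_of_hodgeNumber_mul_eq_zero`, **`…quadricThreefold_tensor`** (`HC(Q × Z)` ⟸ `HC(Z)`),
  `…quinticThreefold_tensor_of_hodgeNumber_eq_zero`.

DEVIATIONS / SCOPE.  `HC(Z)` is a hypothesis wherever `dim Z ≥ 4`; the middle Hodge numbers of `X` other than `h^{m,0}` stay inside the products (e.g. `h^{2,1}(cubic threefold) = 5` is not a tree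
theorem).  No definitions.

## References
* [VoisinHodgeI2002] C. Voisin, *Hodge Theory and Complex Algebraic Geometry I* (2002) — §7.1.1; §11.1.2 Prop. 11.20; §11.3.1 Thm. 11.30; §11.3.3 Thm. 11.38–11.40, Lemma 11.41, pp. 285–287.
* [VoisinHodgeII2003] C. Voisin, *Hodge Theory and Complex Algebraic Geometry II* (2003) — §1.2.3 Cor. 1.24, Cor. 1.25; §9.2.4 Prop. 9.20.
* [Huybrechts2016K3] D. Huybrechts, *Lectures on K3 Surfaces* (2016) — Ch. 3 Def. 2.5, Lemma 3.1.
* [DeligneHodgeII1971] P. Deligne, *Théorie de Hodge II* (1971) — 1.2.5, 2.1.13.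
* [Deligne2000] P. Deligne, *The Hodge conjecture* (Clay, 2000) — §1.
* [Hartshorne1977] R. Hartshorne, *Algebraic Geometry* (1977) — II Example 8.20.3.
* [EisenbudHarris2016] D. Eisenbud, J. Harris, *3264 and All That* (2016) — Example 5.24, Table 5.1.
* [Arapura2012] D. Arapura, *Algebraic Geometry over the Complex Numbers* (2012) — §17.3 (17.3.1).

## Provenance
Lane `lit-hodgefound` (Hodge path, Track 2), prover seat `lit-hodgefound-p21` (generation 41), self-proposed row g41-#3 (sequel of g40-#7 and g41-#1∕#2; uses p29's `BettiHodgeConjectureProductsOffMiddleAlgebraicFactor`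
and `MaxRationalSubHodgeStructureKunnethSymmetric`).
-/

noncomputable section

open scoped TensorProduct
open CategoryTheory MonoidalCategory Module
open Literature.AlgebraicTopology.SingularHomology

namespace Literature.AlgebraicGeometry.Motives.IsSmoothHypersurface

open Literature.AlgebraicGeometry.Motives
open Literature.AlgebraicGeometry.Motives.HodgeStructure
open Literature.AlgebraicGeometry.HodgeTheory

variable {m n e d : ℕ} {X Z S T T' : SchemeOver ℂ}

/-! ### §1 Off the middle, the even cohomology of a smooth hypersurface is of pure type -/

section Pure

/-- **`h^{p′,q′}(H^{2p}(X)) = 0` for `p′ ≠ p` and `2p ≠ dim X`** on a smooth hypersurface `X`: off the middle degree `H^{2p}(X;ℚ) = Hdgᵖ` (Lefschetz; the tree's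
`hodgeClasses_hodge_eq_top_of_two_mul_ne`), so the Hodge structure is pure of type `(p,p)`. [cite: VoisinHodgeII2003, §1.2.3 Cor. 1.24 and Cor. 1.25] [cite: VoisinHodgeI2002, §7.1.1 and §11.1.2 Prop. 11.20] -/
theorem hodgeNumber_hodge_eq_zero_of_two_mul_ne (hY : IsSmoothHypersurface m e X) (hHD : exists_isReal_hodgeModel) (hX : IsSmoothProjective m X) {p : ℕ} (hp : 2 * p ≠ m) {p' q' : ℤ}
    (hne : p' ≠ p) : (BettiUniverse.hodge hHD hX (2 * p)).hodgeNumber p' q' = 0 :=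
  (BettiUniverse.hodge hHD hX (2 * p)).hodgeNumber_eq_zero_of_hodgeClasses_eq_top (p := p) (by push_cast; ring) (hY.hodgeClasses_hodge_eq_top_of_two_mul_ne hHD hX hp) hne

end Pure

/-! ### §2 Odd-dimensional hypersurfaces times `Z`: the numerical level criterion with ONE family of products -/

section Odd

/-- **AN ODD-DIMENSIONAL SMOOTH HYPERSURFACE TIMES ANYTHING, numerically.**  `X ⊂ ℙ^{2r+2}_ℂ` smooth of dimension `m = 2r + 1` (any degree; `HC(X)` holds), `Z` smooth projective of dimension `n` with `HC(Z)` and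
top odd degree `2t + 1` (`2t+1 ≤ n ≤ 2t+2`): **`HC(X × Z)` ⟸ `h^{r+1+k, r−k}(X) · h^{t+1+k, t−k}(Z) = 0` for `0 ≤ k ≤ min(r, t)`** — the seat's numerical level criterion (g40-#7) with its even-degree
products vanishing identically (`H^{2r}(X)` is of pure type `(r,r)`, §1). [cite: VoisinHodgeI2002, §7.1.1, §11.3.3 Thm. 11.38–11.40, Lemma 11.41, pp. 285–287] [cite: VoisinHodgeII2003, §1.2.3 Cor. 1.24–1.25 and §9.2.4 Prop. 9.20]
[cite: Huybrechts2016K3, Ch. 3 Def. 2.5 and Lemma 3.1] [cite: DeligneHodgeII1971, 1.2.5 and 2.1.13] [cite: Deligne2000, §1] -/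
theorem hodgeConjectureFor_tensor_of_odd_of_forall_hodgeNumber_mul_eq_zero (hXh : IsSmoothHypersurface m e X) (hHD : exists_isReal_hodgeModel) {r : ℕ} (hm : m = 2 * r + 1)
    (hZ : IsSmoothProjective n Z) (hHCZ : HodgeConjectureFor n Z) {t : ℕ} (ht : 2 * t + 1 ≤ n) (hnt : n ≤ 2 * t + 2)
    (hodd : ∀ k : ℕ, k ≤ r → k ≤ t →
      (BettiUniverse.hodge hHD hXh.1 (2 * r + 1)).hodgeNumber ((r : ℤ) + 1 + k) ((r : ℤ) - k) * (BettiUniverse.hodge hHD hZ (2 * t + 1)).hodgeNumber ((t : ℤ) + 1 + k) ((t : ℤ) - k) = 0) :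
    HodgeConjectureFor (m + n) (X ⊗ Z) := by
  subst hm
  exact BettiUniverse.hodgeConjectureFor_tensor_of_forall_hodgeNumber_mul_eq_zero hHD hXh.1 hZ (hXh.1.tensor_holds hZ) (hXh.hodgeConjectureFor_of_odd hHD ⟨r, rfl⟩) hHCZ (r := r) le_rfl
    (by omega) ht hnt hodd (μ := r) (by omega) le_rfl (ν := n / 2) (by omega) (by omega) fun k hk1 _ _ ↦ by
      rw [hXh.hodgeNumber_hodge_eq_zero_of_two_mul_ne hHD hXh.1 (p := r) (by omega) (by omega), zero_mul]

/-- The mirror: **`HC(Z × X)`** under the same products. [cite: VoisinHodgeI2002, §11.3.3 Lemma 11.41, pp. 285–287] [cite: VoisinHodgeII2003, §1.2.3 Cor. 1.24–1.25 and §9.2.4 Prop. 9.20] -/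
theorem hodgeConjectureFor_tensor_right_of_odd_of_forall_hodgeNumber_mul_eq_zero (hXh : IsSmoothHypersurface m e X) (hHD : exists_isReal_hodgeModel) {r : ℕ} (hm : m = 2 * r + 1)
    (hZ : IsSmoothProjective n Z) (hHCZ : HodgeConjectureFor n Z) {t : ℕ} (ht : 2 * t + 1 ≤ n) (hnt : n ≤ 2 * t + 2)
    (hodd : ∀ k : ℕ, k ≤ r → k ≤ t →
      (BettiUniverse.hodge hHD hXh.1 (2 * r + 1)).hodgeNumber ((r : ℤ) + 1 + k) ((r : ℤ) - k) * (BettiUniverse.hodge hHD hZ (2 * t + 1)).hodgeNumber ((t : ℤ) + 1 + k) ((t : ℤ) - k) = 0) :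
    HodgeConjectureFor (n + m) (Z ⊗ X) :=
  (hodgeConjectureFor_tensor_comm hXh.1 hZ).1 (hXh.hodgeConjectureFor_tensor_of_odd_of_forall_hodgeNumber_mul_eq_zero hHD hm hZ hHCZ ht hnt hodd)

/-- **THE FANO RANGE `e ≤ 2r + 2`: the top level `k = r` drops** (`h^{2r+1,0}(X) = 0`, the seat's g41-#1 `hodgeNumber_hodge_top_zero_eq_zero_of_le`): `HC(X × Z)` ⟸ `HC(Z)`,
`h^{r+1+k, r−k}(X) · h^{t+1+k, t−k}(Z) = 0` for `0 ≤ k < r` (`k ≤ t`). [cite: Hartshorne1977, II Example 8.20.3] [cite: VoisinHodgeI2002, §11.3.3 Lemma 11.41, pp. 285–287]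
[cite: VoisinHodgeII2003, §1.2.3 Cor. 1.24–1.25 and §9.2.4 Prop. 9.20] [cite: Deligne2000, §1] -/
theorem hodgeConjectureFor_tensor_of_odd_of_le_of_forall_hodgeNumber_mul_eq_zero (hXh : IsSmoothHypersurface m e X) (hHD : exists_isReal_hodgeModel) {r : ℕ} (hm : m = 2 * r + 1)
    (he : e ≤ m + 1) (hZ : IsSmoothProjective n Z) (hHCZ : HodgeConjectureFor n Z) {t : ℕ} (ht : 2 * t + 1 ≤ n) (hnt : n ≤ 2 * t + 2)
    (hodd : ∀ k : ℕ, k < r → k ≤ t →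
      (BettiUniverse.hodge hHD hXh.1 (2 * r + 1)).hodgeNumber ((r : ℤ) + 1 + k) ((r : ℤ) - k) * (BettiUniverse.hodge hHD hZ (2 * t + 1)).hodgeNumber ((t : ℤ) + 1 + k) ((t : ℤ) - k) = 0) :
    HodgeConjectureFor (m + n) (X ⊗ Z) := by
  refine hXh.hodgeConjectureFor_tensor_of_odd_of_forall_hodgeNumber_mul_eq_zero hHD hm hZ hHCZ ht hnt fun k hkr hkt ↦ ?_
  rcases hkr.lt_or_eq with hlt | rfl
  · exact hodd k hlt hkt
  · subst hm
    rw [show (k : ℤ) + 1 + k = ((2 * k + 1 : ℕ) : ℤ) by push_cast; ring, show (k : ℤ) - k = 0 by ring, hXh.hodgeNumber_hodge_top_zero_eq_zero_of_le (by omega) he hHD hXh.1, zero_mul]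

end Odd

/-! ### §3 Every surface times every odd-dimensional hypersurface -/

section Surface

/-- **EVERY SURFACE TIMES EVERY ODD-DIMENSIONAL HYPERSURFACE: `HC(S × X)` ⟸ `q(S) · h^{r+1, r}(X) = 0`** (`S` any smooth projective surface, `X ⊂ ℙ^{2r+2}` a smooth hypersurface of dimension
`2r + 1`; the `p_g`-clause `p_g(S) · h^{r+1,r−1}(H^{2r}X) = 0` of the seat's g40-#7 surface criterion is automatic, `H^{2r}(X)` being pure). [cite: VoisinHodgeI2002, §7.1.1, §11.3.1 Thm. 11.30, §11.3.3 Lemma 11.41, pp. 285–287]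
[cite: VoisinHodgeII2003, §1.2.3 Cor. 1.24–1.25 and §9.2.4 Prop. 9.20] [cite: Huybrechts2016K3, Ch. 3 Def. 2.5 and Lemma 3.1] [cite: Deligne2000, §1] -/
theorem hodgeConjectureFor_surface_tensor_of_odd_of_hodgeNumber_mul_eq_zero (hXh : IsSmoothHypersurface m e X) (hHD : exists_isReal_hodgeModel) {r : ℕ} (hm : m = 2 * r + 1) (hS : IsSmoothProjective 2 S)
    (hq : (BettiUniverse.hodge hHD hS 1).hodgeNumber 1 0 * (BettiUniverse.hodge hHD hXh.1 (2 * r + 1)).hodgeNumber ((r : ℤ) + 1) r = 0) : HodgeConjectureFor (2 + m) (S ⊗ X) := by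
  subst hm
  exact BettiUniverse.hodgeConjectureFor_surface_tensor_of_hodgeNumber_mul_eq_zero hHD hS hXh.1 (hS.tensor_holds hXh.1) (hXh.hodgeConjectureFor_of_odd hHD ⟨r, rfl⟩) (t := r) le_rfl (by omega)
    (ν := r) (by omega) le_rfl hq (by rw [hXh.hodgeNumber_hodge_eq_zero_of_two_mul_ne hHD hXh.1 (p := r) (by omega) (by omega), mul_zero])

/-- **EVERY REGULAR SURFACE TIMES EVERY ODD-DIMENSIONAL HYPERSURFACE SATISFIES THE HODGE CONJECTURE**: `q(S) = 0` ⟹ `HC(S × X)` (e.g. `S ⊂ ℙ³` any smooth surface, an Enriques or a regular elliptic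
surface, times a cubic or quintic threefold, a cubic fivefold, …). [cite: VoisinHodgeI2002, §7.1.1, §11.3.1 Thm. 11.30, §11.3.3 Lemma 11.41, pp. 285–287] [cite: VoisinHodgeII2003, §1.2.3 Cor. 1.24–1.25 and §9.2.4 Prop. 9.20]
[cite: Deligne2000, §1] -/
theorem hodgeConjectureFor_surface_tensor_of_odd_of_q_zero (hXh : IsSmoothHypersurface m e X) (hHD : exists_isReal_hodgeModel) (hm : Odd m) (hS : IsSmoothProjective 2 S)
    (hq : (BettiUniverse.hodge hHD hS 1).hodgeNumber 1 0 = 0) : HodgeConjectureFor (2 + m) (S ⊗ X) := by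
  obtain ⟨r, hr⟩ := hm
  exact hXh.hodgeConjectureFor_surface_tensor_of_odd_of_hodgeNumber_mul_eq_zero hHD hr hS (by rw [hq, zero_mul])

/-- The mirror `HC(X × S)` for a regular surface `S`. [cite: VoisinHodgeI2002, §11.3.3 Lemma 11.41, pp. 285–287] [cite: VoisinHodgeII2003, §1.2.3 Cor. 1.24–1.25] -/
theorem hodgeConjectureFor_tensor_surface_of_odd_of_q_zero (hXh : IsSmoothHypersurface m e X) (hHD : exists_isReal_hodgeModel) (hm : Odd m) (hS : IsSmoothProjective 2 S)
    (hq : (BettiUniverse.hodge hHD hS 1).hodgeNumber 1 0 = 0) : HodgeConjectureFor (m + 2) (X ⊗ S) :=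
  (hodgeConjectureFor_tensor_comm hS hXh.1).1 (hXh.hodgeConjectureFor_surface_tensor_of_odd_of_q_zero hHD hm hS hq)

/-- **A smooth surface in `ℙ³` times an odd-dimensional smooth hypersurface satisfies the Hodge conjecture** (`q(S_d) = 0`). [cite: VoisinHodgeII2003, §1.2.3 Cor. 1.24–1.25 and §9.2.4 Prop. 9.20]
[cite: VoisinHodgeI2002, §11.3.3 Lemma 11.41, pp. 285–287] [cite: Deligne2000, §1] -/
theorem hodgeConjectureFor_surface_tensor_of_odd_of_isSmoothHypersurface_two (hXh : IsSmoothHypersurface m e X) (hHD : exists_isReal_hodgeModel) (hm : Odd m) (hS : IsSmoothHypersurface 2 d S) :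
    HodgeConjectureFor (2 + m) (S ⊗ X) :=
  hXh.hodgeConjectureFor_surface_tensor_of_odd_of_q_zero hHD hm hS.1 (by exact_mod_cast hS.hodgeNumber_hodge_eq_zero_of_odd hHD hS.1 odd_one (by norm_num) (p := 1) (q := 0) rfl)

end Surface

/-! ### §4 Hypersurface threefolds times `Z`: `h^{2,1}(T) · h^{t+1,t}(Z)` and `h^{3,0}(T) · h^{t+2,t−1}(Z)`; degree `≤ 4`; the quintic threefold -/

section Threefold

/-- **A HYPERSURFACE THREEFOLD TIMES `Z`: `HC(T × Z)` ⟸ `HC(Z)`, `h^{2,1}(T) · h^{t+1,t}(Z) = 0` and, when `t ≥ 1`, `h^{3,0}(T) · h^{t+2,t−1}(Z) = 0`** (`T ⊂ ℙ⁴_ℂ` smooth of any degree, `2t+1` the top odd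
degree of `Z`). [cite: VoisinHodgeI2002, §7.1.1, §11.3.3 Thm. 11.38–11.40, Lemma 11.41, pp. 285–287] [cite: VoisinHodgeII2003, §1.2.3 Cor. 1.24–1.25 and §9.2.4 Prop. 9.20] [cite: Deligne2000, §1] -/
theorem hodgeConjectureFor_threefold_tensor_of_hodgeNumber_mul_eq_zero (hT : IsSmoothHypersurface 3 e T) (hHD : exists_isReal_hodgeModel) (hZ : IsSmoothProjective n Z) (hHCZ : HodgeConjectureFor n Z)
    {t : ℕ} (ht : 2 * t + 1 ≤ n) (hnt : n ≤ 2 * t + 2) (h21 : (BettiUniverse.hodge hHD hT.1 3).hodgeNumber 2 1 * (BettiUniverse.hodge hHD hZ (2 * t + 1)).hodgeNumber ((t : ℤ) + 1) t = 0)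
    (h30 : 1 ≤ t → (BettiUniverse.hodge hHD hT.1 3).hodgeNumber 3 0 * (BettiUniverse.hodge hHD hZ (2 * t + 1)).hodgeNumber ((t : ℤ) + 2) ((t : ℤ) - 1) = 0) :
    HodgeConjectureFor (3 + n) (T ⊗ Z) :=
  hT.hodgeConjectureFor_tensor_of_odd_of_forall_hodgeNumber_mul_eq_zero hHD (r := 1) rfl hZ hHCZ ht hnt fun k hk hkt ↦ by
    rcases (show k = 0 ∨ k = 1 by omega) with rfl | rfl
    · rw [show ((1 : ℕ) : ℤ) + 1 + ((0 : ℕ) : ℤ) = 2 by norm_num, show ((1 : ℕ) : ℤ) - ((0 : ℕ) : ℤ) = 1 by norm_num, show (t : ℤ) + 1 + ((0 : ℕ) : ℤ) = t + 1 by norm_num,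
        show (t : ℤ) - ((0 : ℕ) : ℤ) = t by norm_num]
      exact h21
    · rw [show ((1 : ℕ) : ℤ) + 1 + ((1 : ℕ) : ℤ) = 3 by norm_num, show ((1 : ℕ) : ℤ) - ((1 : ℕ) : ℤ) = 0 by norm_num, show (t : ℤ) + 1 + ((1 : ℕ) : ℤ) = t + 2 by push_cast; ring,
        show (t : ℤ) - ((1 : ℕ) : ℤ) = t - 1 by norm_num]
      exact h30 hkt

/-- **A hypersurface threefold of degree `≤ 4` times `Z`: `HC(T × Z)` ⟸ `HC(Z)`, `h^{2,1}(T) · h^{t+1,t}(Z) = 0`** (quadric, cubic, quartic threefolds: `h^{3,0}(T) = 0`).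
[cite: Hartshorne1977, II Example 8.20.3] [cite: VoisinHodgeI2002, §11.3.3 Lemma 11.41, pp. 285–287] [cite: VoisinHodgeII2003, §1.2.3 Cor. 1.24–1.25 and §9.2.4 Prop. 9.20] [cite: Deligne2000, §1] -/
theorem hodgeConjectureFor_threefold_of_le_four_tensor_of_hodgeNumber_mul_eq_zero (hT : IsSmoothHypersurface 3 e T) (he : e ≤ 4) (hHD : exists_isReal_hodgeModel) (hZ : IsSmoothProjective n Z)
    (hHCZ : HodgeConjectureFor n Z) {t : ℕ} (ht : 2 * t + 1 ≤ n) (hnt : n ≤ 2 * t + 2)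
    (h21 : (BettiUniverse.hodge hHD hT.1 3).hodgeNumber 2 1 * (BettiUniverse.hodge hHD hZ (2 * t + 1)).hodgeNumber ((t : ℤ) + 1) t = 0) : HodgeConjectureFor (3 + n) (T ⊗ Z) :=
  hT.hodgeConjectureFor_threefold_tensor_of_hodgeNumber_mul_eq_zero hHD hZ hHCZ ht hnt h21 fun _ ↦ by rw [hT.hodgeNumber_three_zero_eq_zero_of_le_four he hHD, zero_mul]

/-- **A hypersurface threefold of degree `≤ 4` times `Z` with `h^{t+1,t}(Z) = 0`: `HC(T × Z)` ⟸ `HC(Z)`** (e.g. a cubic threefold times a threefold with `h^{2,1} = 0`, a fourfold with `h^{2,1} = 0`, a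
variety without odd cohomology). [cite: VoisinHodgeI2002, §11.3.3 Lemma 11.41, pp. 285–287] [cite: VoisinHodgeII2003, §1.2.3 Cor. 1.24–1.25 and §9.2.4 Prop. 9.20] [cite: Deligne2000, §1] -/
theorem hodgeConjectureFor_threefold_of_le_four_tensor_of_hodgeNumber_eq_zero (hT : IsSmoothHypersurface 3 e T) (he : e ≤ 4) (hHD : exists_isReal_hodgeModel) (hZ : IsSmoothProjective n Z)
    (hHCZ : HodgeConjectureFor n Z) {t : ℕ} (ht : 2 * t + 1 ≤ n) (hnt : n ≤ 2 * t + 2) (h1 : (BettiUniverse.hodge hHD hZ (2 * t + 1)).hodgeNumber ((t : ℤ) + 1) t = 0) :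
    HodgeConjectureFor (3 + n) (T ⊗ Z) :=
  hT.hodgeConjectureFor_threefold_of_le_four_tensor_of_hodgeNumber_mul_eq_zero he hHD hZ hHCZ ht hnt (by rw [h1, mul_zero])

/-- **A hypersurface threefold of degree `≤ 4` (e.g. a cubic threefold) times a threefold `T′` with `h^{2,1}(T′) = 0`: `HC(T × T′)`** unconditionally (`HC(T′)` by Lefschetz). [cite: VoisinHodgeI2002, §11.3.1 Thm. 11.30, §11.3.3 Lemma 11.41, pp. 285–287]
[cite: VoisinHodgeII2003, §1.2.3 Cor. 1.24–1.25 and §9.2.4 Prop. 9.20] [cite: Deligne2000, §1] -/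
theorem hodgeConjectureFor_threefold_of_le_four_tensor_threefold_of_h21_eq_zero (hT : IsSmoothHypersurface 3 e T) (he : e ≤ 4) (hHD : exists_isReal_hodgeModel) (hT' : IsSmoothProjective 3 T')
    (h21 : (BettiUniverse.hodge hHD hT' 3).hodgeNumber 2 1 = 0) : HodgeConjectureFor (3 + 3) (T ⊗ T') :=
  hT.hodgeConjectureFor_threefold_of_le_four_tensor_of_hodgeNumber_eq_zero he hHD hT' (hodgeConjectureFor_of_dim_le_three_holds le_rfl hT') (t := 1) (by norm_num) (by norm_num)
    (by rw [show ((1 : ℕ) : ℤ) + 1 = 2 by norm_num]; exact h21)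

/-- **Two hypersurface threefolds of degree `≤ 4`: `HC(T × T′)` ⟸ `h^{2,1}(T) · h^{2,1}(T′) = 0`** (e.g. one of them a quadric threefold, `b₃ = 0`). [cite: VoisinHodgeI2002, §11.3.3 Lemma 11.41, pp. 285–287]
[cite: VoisinHodgeII2003, §1.2.3 Cor. 1.24–1.25 and §9.2.4 Prop. 9.20] [cite: EisenbudHarris2016, Example 5.24 and Table 5.1] -/
theorem hodgeConjectureFor_tensor_threefolds_of_le_four_of_hodgeNumber_mul_eq_zero {e' : ℕ} (hT : IsSmoothHypersurface 3 e T) (he : e ≤ 4) (hT' : IsSmoothHypersurface 3 e' T') (hHD : exists_isReal_hodgeModel)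
    (h21 : (BettiUniverse.hodge hHD hT.1 3).hodgeNumber 2 1 * (BettiUniverse.hodge hHD hT'.1 3).hodgeNumber 2 1 = 0) : HodgeConjectureFor (3 + 3) (T ⊗ T') :=
  hT.hodgeConjectureFor_threefold_of_le_four_tensor_of_hodgeNumber_mul_eq_zero he hHD hT'.1 (hT'.hodgeConjectureFor_of_odd hHD (by decide)) (t := 1) (by norm_num) (by norm_num)
    (by rw [show ((1 : ℕ) : ℤ) + 1 = 2 by norm_num]; exact h21)

/-- **A quadric threefold times anything: `HC(Q × Z)` ⟸ `HC(Z)`** (`b₃(Q) = 0`, the seat's g41-#2 `finrank_bettiCohomology_three_quadricThreefold`… here through `h^{2,1}(Q) = 0`).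
[cite: EisenbudHarris2016, Example 5.24 and Table 5.1] [cite: VoisinHodgeII2003, §1.2.3 Cor. 1.24–1.25 and §9.2.4 Prop. 9.20] [cite: Deligne2000, §1] -/
theorem hodgeConjectureFor_quadricThreefold_tensor (hT : IsSmoothHypersurface 3 2 T) (hHD : exists_isReal_hodgeModel) (hZ : IsSmoothProjective n Z) (hHCZ : HodgeConjectureFor n Z) (hn : 1 ≤ n) :
    HodgeConjectureFor (3 + n) (T ⊗ Z) := by
  obtain ⟨t, ht⟩ : ∃ t : ℕ, 2 * t + 1 ≤ n ∧ n ≤ 2 * t + 2 := by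
    rcases Nat.even_or_odd n with ⟨l, hl⟩ | ⟨l, hl⟩
    · exact ⟨l - 1, by omega, by omega⟩
    · exact ⟨l, by omega, by omega⟩
  refine hT.hodgeConjectureFor_threefold_of_le_four_tensor_of_hodgeNumber_mul_eq_zero (by norm_num) hHD hZ hHCZ ht.1 ht.2 ?_
  have hb : Module.finrank ℚ (bettiCohomology T 3) = 0 := by
    have h := hT.finrank_bettiCohomology_middle_odd_le_div (r := 1) rfl
    norm_num at h
    exact h
  rw [show ((BettiUniverse.hodge hHD hT.1 3).hodgeNumber 2 1 = 0) from by exact_mod_cast BettiUniverse.hodgeNumber_hodge_eq_zero_of_finrank_eq_zero hHD hT.1 (k := 3) (p := 2) (q := 1) rfl hb,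
    zero_mul]

/-- **The quintic threefold times `Z`: `HC(T × Z)` ⟸ `HC(Z)`, `h^{2,1}(T) · h^{t+1,t}(Z) = 0` and (`t ≥ 1`) `h^{t+2,t−1}(Z) = 0`** (`h^{3,0}(T) = 1`). [cite: Arapura2012, §17.3 (17.3.1)]
[cite: VoisinHodgeI2002, §11.3.3 Lemma 11.41, pp. 285–287] [cite: VoisinHodgeII2003, §1.2.3 Cor. 1.24–1.25 and §9.2.4 Prop. 9.20] [cite: Deligne2000, §1] -/
theorem hodgeConjectureFor_quinticThreefold_tensor_of_hodgeNumber_eq_zero (hT : IsSmoothHypersurface 3 5 T) (hHD : exists_isReal_hodgeModel) (hZ : IsSmoothProjective n Z) (hHCZ : HodgeConjectureFor n Z)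
    {t : ℕ} (ht : 2 * t + 1 ≤ n) (hnt : n ≤ 2 * t + 2) (h21 : (BettiUniverse.hodge hHD hT.1 3).hodgeNumber 2 1 * (BettiUniverse.hodge hHD hZ (2 * t + 1)).hodgeNumber ((t : ℤ) + 1) t = 0)
    (h2 : 1 ≤ t → (BettiUniverse.hodge hHD hZ (2 * t + 1)).hodgeNumber ((t : ℤ) + 2) ((t : ℤ) - 1) = 0) : HodgeConjectureFor (3 + n) (T ⊗ Z) :=
  hT.hodgeConjectureFor_threefold_tensor_of_hodgeNumber_mul_eq_zero hHD hZ hHCZ ht hnt h21 fun h1t ↦ by rw [h2 h1t, mul_zero]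

end Threefold

end Literature.AlgebraicGeometry.Motives.IsSmoothHypersurface

end
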